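import Summits.NavierStokesRegularity.NavierStokesRegularity.Theses.QuantisedSymmetry
import Summits.NavierStokesRegularity.NavierStokesRegularity.Theses.Blowup
import Summits.NavierStokesRegularity.NavierStokesRegularity.Theorems.QuantisedSymmetryPolyhedralTruncationBridge
import Summits.NavierStokesRegularity.NavierStokesRegularity.Theorems.QuantisedSymmetryPolyhedralDssProfileExistsOfCell
import Summits.NavierStokesRegularity.NavierStokesRegularity.Theorems.QuantisedSymmetryPolyhedralDssProfileExistsStubNoSmallConstant
import Summits.NavierStokesRegularity.NavierStokesRegularity.Theorems.QuantisedSymmetryPolyhedralDssProfileExistsStubPeriodWindow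
import Literature.Analysis.FluidPDE.SelfSimilarLiouville
import HarnessLib

/-!
# Strategist sketch S19-g18 (independent census, family `-s`) for crux
  `QuantisedSymmetry.PolyhedralDssProfileExists` (stmt-NavierStokesRegularity-1404)

Typed companions of `STRATEGY-CENSUS-s19.md` (cstrat seat s19-g18, 2026-08-29). Nothing here is a
registered stub; every `theorem` is `sorry`-free. Sections:

* §0 summit strength: the crux decides the summit NEGATIVELY through tree theorems
  (`crux_implies_not_summit`).
* §1 weaker intermediates that could replace the crux in `closes` — each still decides the summit
  (`SectorFreeTypeIDssProfileExists`, = the antecedent class of the sector-free truncation bridge;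
  it is stmt-0155 `Blowup.BlowupTypeIDssProfile` up to the rotated clause).
* §2 strengthenings `S⁺`: the rigid regimes with a tool are refuted by landed necessary conditions
  (`no_smallConstantProfile`, `periodWindow_noProfile`); the one unrefuted rigidification
  (`LocallyRigidPolyhedralProfileExists`: existence + local uniqueness modulo the scaling phase) buys
  certifiability, not existence.
* §3 the best typed split: `ApproxGCellFamily ∧ ApproxCellCompactness → crux` (assembly PROVED,
  `crux_of_split`); the compactness half is a provable theorem, so the approximate-family half is the
  crux again modulo a theorem — recorded, not filed.
-/

set_option linter.dupNamespace false

namespace Summit.NavierStokesRegularity.NavierStokesRegularity.Cruxes.PolyhedralDssProfileExists.S19g18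

open MeasureTheory Set Function
open Literature.Analysis.FluidPDE
open _root_.Summit.NavierStokesRegularity.NavierStokesRegularity.Theses

noncomputable section

/-- The Euclidean 3-space of the summit statement. -/
abbrev E3 := EuclideanSpace ℝ (Fin 3)

/-- The symmetry data of the crux: a finite group of rotations acting irreducibly. -/
def IsPolyhedralGroup (G : Subgroup (E3 ≃ₗᵢ[ℝ] E3)) : Prop :=
  Finite G ∧ (∀ g ∈ G, LinearMap.det (g.toLinearEquiv : E3 →ₗ[ℝ] E3) = 1) ∧
    (∀ V : Submodule ℝ E3, (∀ g ∈ G, ∀ v ∈ V, g v ∈ V) → V = ⊥ ∨ V = ⊤)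

/-- The profile clauses of the crux for a given group `G`, factor `c` and Type-I constant `C₀`. -/
def IsGProfile (G : Subgroup (E3 ≃ₗᵢ[ℝ] E3)) (c C₀ : ℝ) (u : ℝ → E3 → E3) : Prop :=
  IsAncientMildSolution 1 u ∧ (∀ t < 0, AEStronglyMeasurable (u t) volume) ∧
    IsDiscretelySelfSimilar c u ∧ HasTypeIDecay C₀ u ∧ (∀ g ∈ G, ∀ t x, u t (g x) = g (u t x)) ∧
    ¬ (∀ t < 0, u t =ᵐ[volume] 0)

/-- The crux, regrouped through `IsPolyhedralGroup` / `IsGProfile` (definitionally the route decl up to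
the position of the `∃ C₀`). -/
theorem crux_iff :
    QuantisedSymmetry.PolyhedralDssProfileExists ↔
      ∃ G, IsPolyhedralGroup G ∧ ∃ c : ℝ, 1 < c ∧ ∃ C₀ : ℝ, ∃ u, IsGProfile G c C₀ u := by
  constructor
  · rintro ⟨G, hfin, hdet, hirr, c, hc, u, hanc, hmeas, hdss, ⟨C₀, hdec⟩, heqv, hnt⟩
    exact ⟨G, ⟨hfin, hdet, hirr⟩, c, hc, C₀, u, hanc, hmeas, hdss, hdec, heqv, hnt⟩
  · rintro ⟨G, ⟨hfin, hdet, hirr⟩, c, hc, C₀, u, hanc, hmeas, hdss, hdec, heqv, hnt⟩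
    exact ⟨G, hfin, hdet, hirr, c, hc, u, hanc, hmeas, hdss, ⟨C₀, hdec⟩, heqv, hnt⟩

/-! ## §0 Summit strength: the crux implies `¬ NavierStokesRegularity` by tree theorems -/

/-- `PolyhedralDssProfileExists → ¬ NavierStokesRegularity`: the route's deciding theorem `closes` with
its two other binders discharged by the landed proofs of `PolyhedralTruncationBridge` (stmt-11331) and
`ClayUniqueness` (stmt-0153). Hence the crux is at least as strong as the (negative) summit. -/
theorem crux_implies_not_summit (hX : QuantisedSymmetry.PolyhedralDssProfileExists) :
    ¬ _root_.NavierStokesRegularity :=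
  QuantisedSymmetry.closes hX
    _root_.Summit.NavierStokesRegularity.NavierStokesRegularity.Theorems.quantisedSymmetry_polyhedralTruncationBridge_proof
    QuantisedSymmetry.ClayUniqueness_holds

/-! ## §1 Weaker intermediates (drop the symmetry): still summit-deciding -/

/-- (I1) A sector-free Type-I DSS profile: the crux with every `G`-clause removed. -/
def SectorFreeTypeIDssProfileExists : Prop :=
  ∃ c : ℝ, 1 < c ∧ ∃ u : ℝ → E3 → E3,
    IsAncientMildSolution 1 u ∧ (∀ t < 0, AEStronglyMeasurable (u t) volume) ∧
      IsDiscretelySelfSimilar c u ∧ (∃ C₀ : ℝ, HasTypeIDecay C₀ u) ∧ ¬ (∀ t < 0, u t =ᵐ[volume] 0)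

/-- The crux implies (I1) (projection). -/
theorem sectorFree_of_crux (hX : QuantisedSymmetry.PolyhedralDssProfileExists) :
    SectorFreeTypeIDssProfileExists := by
  obtain ⟨G, -, -, -, c, hc, u, hanc, hmeas, hdss, hdec, -, hnt⟩ := hX
  exact ⟨c, hc, u, hanc, hmeas, hdss, hdec, hnt⟩

/-- (I1) negates Tsai's Type-I DSS Liouville conjecture for its factor. -/
theorem not_typeIDSSLiouville_of_sectorFree (h : SectorFreeTypeIDssProfileExists) :
    ∃ c : ℝ, 1 < c ∧ ¬ TypeIDSSLiouville c := by
  obtain ⟨c, hc, u, hanc, hmeas, hdss, hdec, hnt⟩ := h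
  exact ⟨c, hc, fun hL => hnt (hL hc u hanc hmeas hdss hdec)⟩

/-- (I1) implies stmt-0155 `Blowup.BlowupTypeIDssProfile` (deciding crux side of route Blowup). -/
theorem blowupTypeIDssProfile_of_sectorFree (h : SectorFreeTypeIDssProfileExists) :
    Blowup.BlowupTypeIDssProfile := by
  obtain ⟨c, hc, u, hanc, hmeas, hdss, hdec, hnt⟩ := h
  dsimp only [Blowup.BlowupTypeIDssProfile]
  intro hL
  exact hnt ((hL c).1 hc u hanc hmeas hdss hdec)

/-! ## §2 Strengthenings `S⁺` -/

/-- (S⁺₁, refuted) a profile with Type-I constant at most `ε`. -/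
def SmallConstantProfileExists (ε : ℝ) : Prop :=
  ∃ G, IsPolyhedralGroup G ∧ ∃ c : ℝ, 1 < c ∧ ∃ C₀ : ℝ, C₀ ≤ ε ∧ ∃ u, IsGProfile G c C₀ u

/-- Refutation of S⁺₁ for the absolute `ε` of N2 `stub_noSmallConstant` (Chae–Wolf 2017 Rem. 1.4 /
Gustafson–Kang–Tsai ε-regularity, landed p159674). -/
theorem no_smallConstantProfile : ∃ ε : ℝ, 0 < ε ∧ ¬ SmallConstantProfileExists ε := by
  obtain ⟨ε, hε, hkill⟩ :=
    _root_.Summit.NavierStokesRegularity.NavierStokesRegularity.Theorems.PolyhedralDssProfileExists.PolyhedralCell.stub_noSmallConstant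
  refine ⟨ε, hε, ?_⟩
  rintro ⟨G, -, c, -, C₀, hC₀, u, hanc, hmeas, -, hdec, -, hnt⟩
  exact hnt (hkill u C₀ hanc hmeas hdec hC₀)

/-- (S⁺₂, refuted regime) factor near `1`: for every Type-I constant there is a window `(1, c₁)` of
factors carrying no profile — N1 `stub_periodWindow` (Chae–Wolf 2017 Thm 1.3, landed p159657). -/
theorem periodWindow_noProfile :
    ∀ C₀ : ℝ, 0 < C₀ → ∃ c₁ : ℝ, 1 < c₁ ∧ ∀ G c, 1 < c → c < c₁ → ∀ u, ¬ IsGProfile G c C₀ u := by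
  intro C₀ hC₀
  obtain ⟨c₁, hc₁, hkill⟩ :=
    _root_.Summit.NavierStokesRegularity.NavierStokesRegularity.Theorems.PolyhedralDssProfileExists.PolyhedralCell.stub_periodWindow
      C₀ hC₀
  refine ⟨c₁, hc₁, ?_⟩
  rintro G c hc hcc₁ u ⟨hanc, hmeas, hdss, hdec, -, hnt⟩
  exact hnt (hkill c u hc hcc₁ hanc hmeas hdss hdec)

/-- (S⁺₃, NOT refuted, no leverage) **locally rigid profile**: a crux profile which is, in the
scale-invariant norm `sup √(-t)‖·‖`, locally unique modulo the scaling phase `u ↦ nsRescale μ u` among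
profiles with the same `(G, c, C₀)`. This is what a Newton–Kantorovich certificate would deliver
(existence + local uniqueness in a ball) and what spectral non-degeneracy of the cell's period map
implies; it is strictly stronger than the crux and inherits none of the Liouville tools. -/
def LocallyRigidPolyhedralProfileExists : Prop :=
  ∃ G, IsPolyhedralGroup G ∧ ∃ c : ℝ, 1 < c ∧ ∃ C₀ : ℝ, ∃ u, IsGProfile G c C₀ u ∧
    ∃ ε : ℝ, 0 < ε ∧ ∀ u', IsGProfile G c C₀ u' →
      (∀ t < 0, ∀ x, Real.sqrt (-t) * ‖u' t x - u t x‖ ≤ ε) → ∃ μ : ℝ, 0 < μ ∧ u' = nsRescale μ u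

/-- S⁺₃ implies the crux (projection). -/
theorem crux_of_locallyRigid (h : LocallyRigidPolyhedralProfileExists) :
    QuantisedSymmetry.PolyhedralDssProfileExists := by
  obtain ⟨G, hG, c, hc, C₀, u, hu, -⟩ := h
  exact crux_iff.2 ⟨G, hG, c, hc, C₀, u, hu⟩

/-! ## §3 The best typed split: approximate cells + compactness -/

/-- The cell clauses of line `polyhedral_cell` WITHOUT the exact closing condition, with an explicit
sup bound `M` (an "open `G`-cell" on the model slab `[-1, -c⁻²]`). -/
def IsOpenGCell (G : Subgroup (E3 ≃ₗᵢ[ℝ] E3)) (c M : ℝ) (v : ℝ → E3 → E3) : Prop :=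
  ContinuousOn (Function.uncurry v) (Set.Icc (-1 : ℝ) (-(c ^ 2)⁻¹) ×ˢ Set.univ) ∧
    (∀ t ∈ Set.Icc (-1 : ℝ) (-(c ^ 2)⁻¹), ∀ x, ‖v t x‖ ≤ M) ∧
    (∀ t ∈ Set.Icc (-1 : ℝ) (-(c ^ 2)⁻¹), IsWeaklyDivFree (v t)) ∧
    (∀ s t : ℝ, -1 ≤ s → s < t → t ≤ -(c ^ 2)⁻¹ → ∀ x,
      v t x = heatFlow (v s) (t - s) x - oseenDuhamel 1 s v v t x) ∧
    (∀ g ∈ G, ∀ t ∈ Set.Icc (-1 : ℝ) (-(c ^ 2)⁻¹), ∀ x, v t (g x) = g (v t x)) ∧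
    MemLp (v (-1)) 4 volume

/-- Closing defect at most `δ` in sup norm: `‖v(-c⁻², x) - c v(-1, cx)‖ ≤ δ` for all `x`. -/
def ClosingDefectLE (c δ : ℝ) (v : ℝ → E3 → E3) : Prop :=
  ∀ x, ‖v (-(c ^ 2)⁻¹) x - c • v (-1) (c • x)‖ ≤ δ

/-- (A) **approximate `G`-cells at every accuracy, with uniform bounds and no escape**: for one polyhedral
`G`, one factor `c > 1`, one sup bound `M`, one anchor `x₀` and one floor `η > 0`, there are, for every
`δ > 0`, open `G`-cells with closing defect `≤ δ` and `‖v(-1, x₀)‖ ≥ η`. (Each fixed-`δ` instance is a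
finite certification target; the crux implies (A) with its own exact cell.) -/
def ApproxGCellFamily : Prop :=
  ∃ G, IsPolyhedralGroup G ∧ ∃ c : ℝ, 1 < c ∧ ∃ M η : ℝ, 0 < η ∧ ∃ x₀ : E3,
    ∀ δ : ℝ, 0 < δ → ∃ v, IsOpenGCell G c M v ∧ ClosingDefectLE c δ v ∧ η ≤ ‖v (-1) x₀‖

/-- (B) **compactness of bounded open cells** (provable: interior parabolic regularity of bounded
Oseen-mild fields ⇒ local equicontinuity ⇒ Arzelà–Ascoli ⇒ dominated convergence in the Oseen–Duhamel
formula; the anchor keeps the limit nontrivial): a uniformly bounded family of open `G`-cells with closing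
defects `→ 0` and a common anchor floor has an exactly closing member of the same class. -/
def ApproxCellCompactness : Prop :=
  ∀ G, IsPolyhedralGroup G → ∀ c : ℝ, 1 < c → ∀ M η : ℝ, 0 < η → ∀ x₀ : E3,
    (∀ δ : ℝ, 0 < δ → ∃ v, IsOpenGCell G c M v ∧ ClosingDefectLE c δ v ∧ η ≤ ‖v (-1) x₀‖) →
      ∃ v, IsOpenGCell G c M v ∧ ClosingDefectLE c 0 v ∧ η ≤ ‖v (-1) x₀‖

/-- **Assembly of the split (kernel-checked): (A) → (B) → crux**, through the landed reduction
`stub_profileOfPolyhedralCell` (one exact polyhedral cell with nonzero `L⁴` datum gives the crux). -/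
theorem crux_of_split (hA : ApproxGCellFamily) (hB : ApproxCellCompactness) :
    QuantisedSymmetry.PolyhedralDssProfileExists := by
  obtain ⟨G, hG, c, hc, M, η, hη, x₀, hfam⟩ := hA
  obtain ⟨v, ⟨hcont, hbd, hdiv, hmild, heqv, hL4⟩, hclose, hanchor⟩ := hB G hG c hc M η hη x₀ hfam
  obtain ⟨hfin, hdet, hirr⟩ := hG
  refine
    _root_.Summit.NavierStokesRegularity.NavierStokesRegularity.Theorems.PolyhedralDssProfileExists.PolyhedralCell.stub_profileOfPolyhedralCell
      ⟨G, hfin, hdet, hirr, c, hc, v, ⟨hcont, ⟨M, hbd⟩, hdiv, hmild, ?_, heqv⟩, hL4, ?_⟩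
  · -- exact closing from defect `≤ 0`
    intro x
    have hx := hclose x
    have : ‖v (-(c ^ 2)⁻¹) x - c • v (-1) (c • x)‖ = 0 := le_antisymm hx (norm_nonneg _)
    exact sub_eq_zero.1 (norm_eq_zero.1 this)
  · -- nontriviality: `v(-1)` is continuous and `‖v(-1, x₀)‖ ≥ η > 0`
    intro hae
    have hmem : (-1 : ℝ) ∈ Set.Icc (-1 : ℝ) (-(c ^ 2)⁻¹) := by
      refine ⟨le_rfl, ?_⟩
      have hc2 : 1 ≤ c ^ 2 := by nlinarith
      have : (c ^ 2)⁻¹ ≤ 1 := inv_le_one_of_one_le₀ hc2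
      linarith
    have hcont1 : Continuous (v (-1)) := by
      have : Continuous (fun x : E3 => Function.uncurry v ((-1 : ℝ), x)) :=
        hcont.comp_continuous (continuous_const.prodMk continuous_id) (fun x => ⟨hmem, Set.mem_univ _⟩)
      simpa [Function.uncurry] using this
    have hzero : v (-1) = 0 := (Continuous.ae_eq_iff_eq volume hcont1 continuous_const).1 hae
    have : ‖v (-1) x₀‖ = 0 := by simp [hzero]
    linarith

/-- The crux implies (A): its own cell (restriction of the profile's continuous representative to the
model slab) is an exact member at every accuracy — recorded informally; the formal direction needs the
landed `stub_cellOfProfile` and is not used by the census. (B) is a compactness THEOREM; hence (A) is the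
crux again modulo (B): the split is bookkeeping, not a redirect. -/
theorem split_is_modus_ponens : (ApproxGCellFamily ∧ ApproxCellCompactness) →
    QuantisedSymmetry.PolyhedralDssProfileExists := fun h => crux_of_split h.1 h.2

end

end Summit.NavierStokesRegularity.NavierStokesRegularity.Cruxes.PolyhedralDssProfileExists.S19g18
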